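import Mathlib.LinearAlgebra.Matrix.Block
import Mathlib.LinearAlgebra.Matrix.Charpoly.Coeff
import Mathlib.Logic.Equiv.Fin.Rotate
import Literature.NumberTheory.GaloisRepresentations.InducedGaloisRep
import Literature.NumberTheory.GaloisRepresentations.FramedRepBlockSum
import Literature.NumberTheory.GaloisRepresentations.ArtinFormalismInductionProofs
import HarnessLib

/-!
# Induction of framed Galois representations: Frobenius characteristic polynomials of `Ind_{Γ_F}^{Γ_K} ρ`

Topic `Literature/NumberTheory/GaloisRepresentations`, notion `FramedGaloisRepInduce` (definition
request `defn-FramedGaloisRepInduce`, wanted by the support item `MurtyGlue` of route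
`Langlands/MonomialConverse`: "induction `Ind` of a framed Galois representation along a finite
extension of number fields, with the lemmas: Frobenius characteristic polynomial at an unramified
place `v` = `inducedSatakePolynomial`-shaped product over `w ∣ v`; compatibility with `blockSum`").

The induced representation itself is already in the tree:
`Literature.NumberTheory.GaloisRepresentations.FramedGaloisRep.induce K hd ρ : FramedGaloisRep K A (d * n)`
(`InducedGaloisRep.lean`; base field `K` first, `hd : Module.finrank K F = d`, matrix form of Serre
§3.3), with its character formula, base change and (for `F/K` Galois) restriction to `Γ_F`.  This file
adds the **Frobenius characteristic polynomials of `Ind_{Γ_F}^{Γ_K} ρ`** for an arbitrary finite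
extension `F/K` of number fields, arbitrary rank `n` and coefficients in any commutative topological
ring `A` (`ℂ`, `ℚ̄_ℓ`, `ℤ_ℓ`, `𝔽̄_ℓ`):

`det(X - Ind(ρ)(Frob_v)) = ∏_{w ∣ v} det(X^{f(w|v)} - ρ(Frob_w))`

at every finite place `v` of `K` unramified in (the Galois closure of) `F`, the Galois side of Artin's
`L(s, Ind ρ) = L(s, ρ)` (Neukirch VII (10.4) (iv)) place by place, in the shape of the induced Satake
polynomial `Literature.NumberTheory.Automorphic.inducedSatakePolynomial` of automorphic induction
(Arthur–Clozel, Ch. 3 §6).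

## Main definitions

* `Literature.NumberTheory.GaloisRepresentations.inducedFrobPolynomial v P =
  ∏ᶠ_{w ∣ v} (P w).comp (X ^ f(w|v))` — the induced Frobenius polynomial of a family of polynomials
  indexed by the places of `F` (`inducedFrobPolynomial_eq_prod`, `_congr`, `_mul`).
* `Literature.NumberTheory.GaloisRepresentations.cyclicShiftBlocks f C` — the weighted block cyclic
  shift, the `f × f` block matrix of `e_t ⊗ v ↦ e_{t+1} ⊗ v`, `e_{f-1} ⊗ v ↦ e_0 ⊗ C v` (the shape of
  `Ind(π)(g)` on one `⟨g⟩`-orbit of cosets).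

## Main results (all proved)

* `charpoly_comp_cyclicShiftBlocks` — `det(X - S(C)) = (charpoly C)(X^f)` (block row reduction to a
  block triangular matrix, Mathlib `Matrix.BlockTriangular.det_fintype`; both sides monic);
  `charmatrix_comp`, `charpoly_comp_blockDiagonal'` (flattened block matrices, Mathlib `Matrix.comp`).
* `charpoly_comp_indMatrix_eq_of_transversal`, `charpoly_comp_indMatrix_eq_prod` — **group theory**:
  for `φ : H →* G` injective (image NOT assumed normal), `π : H →* M_m(A)`, a transversal of
  `G / φ(H)`, `g ∈ G` and representatives `τ_k` of the double cosets `⟨g⟩ \ G / φ(H)` with orbit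
  lengths `f_k` and `φ(s_k) = τ_k⁻¹ g^{f_k} τ_k`:
  `det(X - Ind(π)(g)) = ∏_k (charpoly π(s_k))(X^{f_k})` (Serre §7.3 / Mackey for the cyclic group
  `⟨g⟩`; the rank-one normal case is `Automorphic.Ash2003.charpoly_indMatrix_eq_prod`).
* `exists_frobenius_doubleCoset_data` — **arithmetic** (Neukirch VII §10, proof of (10.4) (iv),
  without normality): for `v` with all inertia groups above `v` inside `res(Γ_F)`, `𝔓 ∣ v` and an
  arithmetic Frobenius `σ` at `𝔓`, the double cosets `⟨σ⟩ \ Γ_K / res(Γ_F)` are the places `w ∣ v`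
  of `F`, the orbit lengths are the residue degrees `f(w|v)`, and `τ_w⁻¹ σ^{f(w|v)} τ_w = res(s_w)`
  with `s_w` an arithmetic Frobenius of `F` at a prime `𝔔_w ∣ w`
  (`FrobeniusGeneration.exists_eq_frobenius_pow_mul_of_mem_decompositionSubgroup` applied to the open
  subgroups `τ_w res(Γ_F) τ_w⁻¹ ⊇ I_𝔓`).
* `FramedGaloisRep.exists_charpoly_induce_eq_prod_comp` — `det(X - Ind(ρ)(σ)) =
  ∏_{w ∣ v} (charpoly ρ(s_w))(X^{f(w|v)})`; `FramedGaloisRep.hasFrobCharpolyAt_induce` —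
  **`ρ.HasFrobCharpolyAt w (P w)` for all `w ∣ v` ⟹ `(Ind ρ).HasFrobCharpolyAt v (inducedFrobPolynomial v P)`**;
  `FramedGaloisRep.hasFrobCharpolyAt_induce_blockSum` — compatibility with `blockSum`
  (`Ind(ρ₁ ⊕ ρ₂)` and `Ind ρ₁ ⊕ Ind ρ₂` have the same Frobenius polynomials).
* `eventually_forall_inertia_le_range_absGaloisRestrict` — for all but finitely many `v`, every
  inertia group above `v` lies in `res(Γ_F)` (via the permutation representation `Ind 1` into the
  discrete `GL_d(ℤ)` and `FramedGaloisRep.eventually_isUnramifiedAt_of_isOpen_ker`); hence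
  `FramedGaloisRep.eventually_hasFrobCharpolyAt_induce`.  (Unramifiedness of `Ind ρ` itself under the
  same inertia hypothesis is `FramedGaloisRep.isUnramifiedAt_induce` of
  `Automorphic/AshSmithTheoryHeckeProofs`, not imported here to keep this file inside the
  Galois-representation import cone; combined with `eventually_forall_inertia_le_range_absGaloisRestrict`
  it gives unramifiedness of `Ind ρ` at all but finitely many places.)

## Not here

Mackey's formula for `Res_{Γ_L} Ind_{Γ_F}^{Γ_K} ρ` at the level of Frobenius polynomials (general
`L`), and the ramified places (Euler factors on inertia invariants: see
`ArtinFormalismInductionProofs` for Artin representations).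

## Mathlib / tree declarations used rather than redefined

`Matrix.comp` / `Matrix.compRingEquiv`, `Matrix.blockDiagonal'`, `Matrix.BlockTriangular`
(`det_fintype`, `.comp`), `Matrix.charpoly_mul_comm`, `Matrix.charpoly_reindex`, `Matrix.det_permute`,
`finRotate`, `Ideal.inertiaDeg`, `IsArithFrobAt`, `finprod`; tree: `indMatrix`, `dotExtend`,
`FramedGaloisRep.induce`, `absGaloisCosetRep` (`InducedGaloisRep`), `FramedGaloisRep.HasFrobCharpolyAt`,
`IsUnramifiedAt` (`GaloisRep`), `FramedGaloisRep.blockSum`, `HasFrobCharpolyAt.blockSum`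
(`FramedRepBlockSum`), `inertiaDeg_dvd_of_forall_pow_residueCard_pow_eq`,
`forall_conj_smul_sub_pow_mem_smul`, `mul_inv_mem_inertia_of_forall_smul_sub_pow_mem`
(`ArtinFormalismInductionProofs`), `AbsIntegersEquiv`, `IntegralGaloisActionProofs`,
`FrobeniusGeneration`, `FramedGaloisRep.eventually_isUnramifiedAt_of_isOpen_ker` (`ArtinRestriction`).
The abstract `Literature.RepresentationTheory.FiniteGroups.reverse_charpoly_restrict_invariants_eq_prod_of_equiv_ind`
(Artin's Euler factor of `σ ≃ ind φ π` with inertia invariants) needs a field of characteristic `0`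
and a finite-index normal subgroup acting trivially (Artin representations); the statement here is
unramified but valid for continuous `ρ` with infinite image and any coefficient ring, as needed for
`ℓ`-adic and mod `ℓ` representations, so it is proved directly on the matrix model.

## References

* J. Neukirch, *Algebraic Number Theory* (1999), I §9 (9.4)–(9.6); VII §10, Prop. (10.4) (iv) and
  its proof, pp. 522–524. [NeukirchANT1999]
* J.-P. Serre, *Linear representations of finite groups*, GTM 42 (1977), §3.3 (Thm. 11–12),
  §7.2–7.3 (Prop. 22, Mackey). [SerreLinearRepresentations1977]
* E. Artin, *Zur Theorie der L-Reihen mit allgemeinen Gruppencharakteren*, Abh. Math. Sem. Univ.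
  Hamburg 8 (1931), §2. [ArtinHamburg1931]
* J.-P. Serre, *Abelian ℓ-adic representations and elliptic curves* (1968), Ch. I §2.3.
  [SerreAbelianLadic1968]
* J. Arthur, L. Clozel, *Simple algebras, base change, and the advanced theory of the trace
  formula*, Ann. of Math. Stud. 120 (1989), Ch. 3 §6 (induced Hecke matrices). [ArthurClozelAMS120]
-/

noncomputable section

open scoped NumberField Pointwise
open Polynomial Matrix IsDedekindDomain Field

namespace Literature.NumberTheory.GaloisRepresentations

universe u v

/-! ### The induced Frobenius polynomial -/

section InducedPolynomial

variable {K : Type u} {F : Type v} [Field K] [Field F] [Algebra K F] {A : Type*} [CommSemiring A]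

/-- **The induced Frobenius polynomial at `v`** of a family `P = (P_w)_w` of polynomials indexed by
the finite places of `F` (meant: `P_w = det(X - ρ(Frob_w))`, the Frobenius characteristic polynomial
of a Galois representation `ρ` of `Γ_F` at `w`):
`∏_{w ∣ v} P_w(X^{f(w|v)})`,
the product over the finitely many places `w` of `F` above the place `v` of `K` (as a `finprod`),
`f(w|v)` the residue degree (Mathlib `Ideal.inertiaDeg`).  It is the Frobenius characteristic
polynomial of `Ind_{Γ_F}^{Γ_K} ρ` at a place `v` unramified in `F`
(`FramedGaloisRep.hasFrobCharpolyAt_induce`), and it has the shape of the induced Satake polynomial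
`Literature.NumberTheory.Automorphic.inducedSatakePolynomial v β = ∏_{w ∣ v} P_{β_w}(X^{f(w|v)})`
(the case `P_w = ∏_{b ∈ β_w} (X - b)`): the Galois side of the compatibility of the Langlands
correspondence with induction, `L(s, Ind ρ) = L(s, ρ)` place by place.
Ref: Neukirch, *Algebraic Number Theory*, VII §10, (10.4) (iv) and its proof, p. 524
(`det(1 - φt; V) = ∏ᵢ det(1 - φᵢ t^{fᵢ}; W)`); Serre, *Linear representations of finite groups*,
§7.3. [folklore] -/
def inducedFrobPolynomial (v : HeightOneSpectrum (𝓞 K)) (P : HeightOneSpectrum (𝓞 F) → A[X]) :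
    A[X] :=
  ∏ᶠ w ∈ {w : HeightOneSpectrum (𝓞 F) | w.asIdeal.under (𝓞 K) = v.asIdeal},
    (P w).comp (X ^ w.asIdeal.inertiaDeg (𝓞 K))

/-- Unfolding lemma for `inducedFrobPolynomial`. [folklore] -/
theorem inducedFrobPolynomial_def (v : HeightOneSpectrum (𝓞 K))
    (P : HeightOneSpectrum (𝓞 F) → A[X]) :
    inducedFrobPolynomial v P =
      ∏ᶠ w ∈ {w : HeightOneSpectrum (𝓞 F) | w.asIdeal.under (𝓞 K) = v.asIdeal},
        (P w).comp (X ^ w.asIdeal.inertiaDeg (𝓞 K)) :=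
  rfl

/-- The induced Frobenius polynomial at `v` only depends on the `P_w` for `w ∣ v`. [folklore] -/
theorem inducedFrobPolynomial_congr (v : HeightOneSpectrum (𝓞 K))
    {P P' : HeightOneSpectrum (𝓞 F) → A[X]}
    (h : ∀ w : HeightOneSpectrum (𝓞 F), w.asIdeal.under (𝓞 K) = v.asIdeal → P w = P' w) :
    inducedFrobPolynomial v P = inducedFrobPolynomial v P' :=
  finprod_mem_congr rfl fun w hw => by rw [h w hw]

variable [NumberField K] [NumberField F]

/-- The set of places of `F` above a place `v` of `K` is finite (they inject into Mathlib's finite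
set `Ideal.primesOver`; cf. `finite_heightOneSpectrum_under_eq`, and the `Type`-monomorphic twin
`Literature.NumberTheory.Automorphic.finite_setOf_asIdeal_under_eq`). [folklore] -/
theorem finite_setOf_asIdeal_under_eq (v : HeightOneSpectrum (𝓞 K)) :
    {w : HeightOneSpectrum (𝓞 F) | w.asIdeal.under (𝓞 K) = v.asIdeal}.Finite := by
  haveI : v.asIdeal.IsMaximal := v.isMaximal
  have hfin := IsDedekindDomain.primesOver_finite v.asIdeal (𝓞 F)
  refine (hfin.preimage (f := fun w : HeightOneSpectrum (𝓞 F) => w.asIdeal)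
    fun _ _ _ _ h => HeightOneSpectrum.ext h).subset ?_
  intro w hw
  have hw' : w.asIdeal.under (𝓞 K) = v.asIdeal := hw
  exact ⟨w.isPrime, ⟨hw'.symm⟩⟩

/-- The induced Frobenius polynomial as a finite product over the places `w ∣ v`. [folklore] -/
theorem inducedFrobPolynomial_eq_prod (v : HeightOneSpectrum (𝓞 K))
    (P : HeightOneSpectrum (𝓞 F) → A[X])
    [Fintype {w : HeightOneSpectrum (𝓞 F) // w.under (𝓞 K) = v}] :
    inducedFrobPolynomial v P =
      ∏ w : {w : HeightOneSpectrum (𝓞 F) // w.under (𝓞 K) = v},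
        (P w.1).comp (X ^ w.1.asIdeal.inertiaDeg (𝓞 K)) := by
  have hS := finite_setOf_asIdeal_under_eq (F := F) v
  rw [inducedFrobPolynomial, finprod_mem_eq_finite_toFinset_prod _ hS]
  refine Finset.prod_subtype _ (fun w => ?_) _
  rw [hS.mem_toFinset, Set.mem_setOf_eq]
  exact ⟨fun h => HeightOneSpectrum.ext h, fun h => congrArg HeightOneSpectrum.asIdeal h⟩

/-- **The induced Frobenius polynomial is multiplicative in `P`** (compatibility of induction with
direct sums at the level of Frobenius polynomials: `Ind(ρ₁ ⊕ ρ₂) ≅ Ind ρ₁ ⊕ Ind ρ₂`). [folklore] -/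
theorem inducedFrobPolynomial_mul (v : HeightOneSpectrum (𝓞 K))
    (P Q : HeightOneSpectrum (𝓞 F) → A[X]) :
    inducedFrobPolynomial v (P * Q) = inducedFrobPolynomial v P * inducedFrobPolynomial v Q := by
  classical
  haveI : Fintype {w : HeightOneSpectrum (𝓞 F) // w.under (𝓞 K) = v} :=
    @Fintype.ofFinite _ (finite_heightOneSpectrum_under_eq v)
  rw [inducedFrobPolynomial_eq_prod, inducedFrobPolynomial_eq_prod, inducedFrobPolynomial_eq_prod,
    ← Finset.prod_mul_distrib]
  refine Finset.prod_congr rfl fun w _ => ?_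
  rw [Pi.mul_apply, mul_comp]

end InducedPolynomial

/-! ### Linear algebra: flattened block matrices -/

section Blocks

variable {R : Type*} [CommRing R] {m : Type*} [Fintype m] [DecidableEq m]

/-- The diagonal block `k` of a flattened block matrix (Mathlib `Matrix.comp`, block index first)
has the determinant of the block `B k k`. [folklore] -/
theorem det_toSquareBlock_comp {ι : Type*} [Fintype ι] [DecidableEq ι]
    (B : Matrix ι ι (Matrix m m R)) (k : ι) :
    ((Matrix.comp ι ι m m R B).toSquareBlock Prod.fst k).det = (B k k).det := by
  let e : m ≃ {x : ι × m // x.1 = k} :=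
    { toFun := fun a => ⟨(k, a), rfl⟩
      invFun := fun x => x.1.2
      left_inv := fun _ => rfl
      right_inv := fun x => by
        rcases x with ⟨⟨k', a⟩, rfl⟩
        rfl }
  rw [← Matrix.det_submatrix_equiv_self e]
  rfl

/-- **The characteristic matrix of a flattened block matrix** is the flattening of the block
matrix `X · 1 - B` (blocks `X · 1_m - B_{ii}` on the diagonal, `-B_{ij}` off it), Mathlib
`Matrix.charmatrix`, `Matrix.compRingEquiv`. [folklore] -/
theorem charmatrix_comp {ι : Type*} [Fintype ι] [DecidableEq ι] (B : Matrix ι ι (Matrix m m R)) :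
    (Matrix.comp ι ι m m R B).charmatrix =
      Matrix.comp ι ι m m R[X]
        (Matrix.scalar ι (Matrix.scalar m (X : R[X])) - B.map (Polynomial.C : R →+* R[X]).mapMatrix) := by
  rw [Matrix.charmatrix, ← Matrix.compRingEquiv_apply, ← Matrix.compRingEquiv_apply, map_sub]
  congr 1
  rw [Matrix.compRingEquiv_apply, Matrix.scalar_apply, Matrix.scalar_apply, Matrix.scalar_apply,
    Matrix.comp_diagonal_diagonal]

omit [DecidableEq m] in
/-- Flattening block matrices is multiplicative (Mathlib `Matrix.compRingEquiv`). [folklore] -/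
theorem comp_mul {ι : Type*} [Fintype ι] (A B : Matrix ι ι (Matrix m m R)) :
    Matrix.comp ι ι m m R (A * B) = Matrix.comp ι ι m m R A * Matrix.comp ι ι m m R B :=
  map_mul (Matrix.compRingEquiv ι m R) A B

/-- The characteristic polynomial of a flattened block diagonal matrix (Mathlib
`Matrix.blockDiagonal'`, blocks of varying sizes) is the product of the characteristic polynomials
of the flattened diagonal blocks. [folklore] -/
theorem charpoly_comp_blockDiagonal' {κ : Type*} [Fintype κ] [DecidableEq κ] {m' : κ → Type*}
    [∀ k, Fintype (m' k)] [∀ k, DecidableEq (m' k)]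
    (N : ∀ k, Matrix (m' k) (m' k) (Matrix m m R)) :
    (Matrix.comp _ _ m m R (Matrix.blockDiagonal' N)).charpoly =
      ∏ k, (Matrix.comp _ _ m m R (N k)).charpoly := by
  classical
  letI : LinearOrder κ :=
    LinearOrder.lift' (Fintype.equivFin κ) (Fintype.equivFin κ).injective
  set N' : ∀ k, Matrix (m' k) (m' k) (Matrix m m R[X]) := fun k =>
    Matrix.scalar (m' k) (Matrix.scalar m (X : R[X])) -
      (N k).map (Polynomial.C : R →+* R[X]).mapMatrix with hN'
  have hbd : Matrix.scalar (Σ k, m' k) (Matrix.scalar m (X : R[X])) -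
      (Matrix.blockDiagonal' N).map (Polynomial.C : R →+* R[X]).mapMatrix =
        Matrix.blockDiagonal' N' := by
    have e1 : Matrix.scalar (Σ k, m' k) (Matrix.scalar m (X : R[X])) =
        Matrix.blockDiagonal' fun k => Matrix.scalar (m' k) (Matrix.scalar m (X : R[X])) := by
      simp only [Matrix.scalar_apply]
      rw [Matrix.blockDiagonal'_diagonal]
    have e2 : (Matrix.blockDiagonal' N).map (Polynomial.C : R →+* R[X]).mapMatrix =
        Matrix.blockDiagonal' fun k => (N k).map (Polynomial.C : R →+* R[X]).mapMatrix :=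
      Matrix.blockDiagonal'_map _ _ (map_zero _)
    rw [e1, e2, ← Matrix.blockDiagonal'_sub]
    rfl
  have hT : (Matrix.comp _ _ m m R[X] (Matrix.blockDiagonal' N')).BlockTriangular
      fun x => x.1.1 :=
    (Matrix.blockTriangular_blockDiagonal' N').comp
  -- the diagonal blocks
  have hdiag : ∀ k, ((Matrix.comp _ _ m m R[X] (Matrix.blockDiagonal' N')).toSquareBlock
      (fun x => x.1.1) k).det = (Matrix.comp _ _ m m R[X] (N' k)).det := fun k => by
    let e : m' k × m ≃ {x : (Σ k, m' k) × m // x.1.1 = k} :=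
      { toFun := fun a => ⟨(⟨k, a.1⟩, a.2), rfl⟩
        invFun := fun x => (cast (congrArg m' x.2) x.1.1.2, x.1.2)
        left_inv := fun _ => rfl
        right_inv := fun x => by
          rcases x with ⟨⟨⟨k', a⟩, b⟩, rfl⟩
          rfl }
    rw [← Matrix.det_submatrix_equiv_self e]
    congr 1
    refine Matrix.ext fun ab ab' => ?_
    rcases ab with ⟨a, b⟩
    rcases ab' with ⟨a', b'⟩
    simp only [Matrix.submatrix_apply, Matrix.toSquareBlock_def, Matrix.of_apply, Matrix.comp_apply]
    change Matrix.blockDiagonal' N' ⟨k, a⟩ ⟨k, a'⟩ b b' = N' k a a' b b'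
    rw [Matrix.blockDiagonal'_apply_eq]
  unfold Matrix.charpoly
  rw [charmatrix_comp, hbd, hT.det_fintype]
  refine Finset.prod_congr rfl fun k _ => ?_
  rw [hdiag, charmatrix_comp]

/-- Two monic polynomials that agree up to a sign `±1` are equal (if the sign is `-1`, comparing
leading coefficients gives `1 = -1` in `R`, and then `-q = q`). [folklore] -/
theorem eq_of_monic_of_eq_sign_mul {p q u : R[X]} (hp : p.Monic) (hq : q.Monic)
    (hu : u = 1 ∨ u = -1) (h : p = u * q) : p = q := by
  rcases hu with rfl | rfl
  · rwa [one_mul] at h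
  · rw [neg_one_mul] at h
    have h1 : (1 : R) = -1 := by
      have := congrArg Polynomial.leadingCoeff h
      rwa [Polynomial.leadingCoeff_neg, hp.leadingCoeff, hq.leadingCoeff] at this
    have h11 : (1 : R) + 1 = 0 := eq_neg_iff_add_eq_zero.mp h1
    have h2 : q + q = 0 := by
      calc q + q = ((1 : R) + 1) • q := by rw [add_smul, one_smul]
        _ = 0 := by rw [h11, zero_smul]
    rw [h]
    exact neg_eq_of_add_eq_zero_left h2

/-- `det (X^f · 1 - C) = (charpoly C)(X^f)` (`Polynomial.comp` is a ring homomorphism, Mathlib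
`RingHom.map_det`). [folklore] -/
theorem det_scalar_X_pow_sub_map (C : Matrix m m R) (f : ℕ) :
    (Matrix.scalar m ((X : R[X]) ^ f) - C.map Polynomial.C).det = C.charpoly.comp (X ^ f) := by
  rw [Matrix.charpoly, ← Polynomial.coe_compRingHom_apply _ (X ^ f), RingHom.map_det]
  congr 1
  ext a b
  rw [RingHom.mapMatrix_apply, Matrix.map_apply, Matrix.charmatrix_apply, Matrix.sub_apply,
    Matrix.scalar_apply, Polynomial.coe_compRingHom_apply, Matrix.map_apply]
  by_cases hab : a = b
  · subst hab
    rw [Matrix.diagonal_apply_eq, Matrix.diagonal_apply_eq, sub_comp, X_comp, C_comp]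
  · rw [Matrix.diagonal_apply_ne _ hab, Matrix.diagonal_apply_ne _ hab, sub_comp, zero_comp,
      C_comp]

end Blocks

/-! ### Linear algebra: the characteristic polynomial of a weighted block cyclic shift -/

section CyclicShift

variable {R : Type*} [CommRing R] {m : Type*} [DecidableEq m]

/-- **The weighted block cyclic shift.**  For `f ≥ 1` and an `m × m` matrix `C`, the `f × f` block
matrix `S(C)` with identity blocks `S(C)_{t+1, t} = 1` (`0 ≤ t < f - 1`), the block `S(C)_{0, f-1} = C`
in the corner and all other blocks `0`: the matrix of `e_t ⊗ v ↦ e_{t+1} ⊗ v` (`t < f - 1`),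
`e_{f-1} ⊗ v ↦ e_0 ⊗ C v`.  It is the shape of `Ind(π)(g)` on one `⟨g⟩`-orbit of cosets in a
transversal adapted to `g`; for `m` a point it is the weighted cyclic shift of
`Literature.NumberTheory.Automorphic.Ash2003.charpoly_cyclicShift`. [folklore] -/
def cyclicShiftBlocks (f : ℕ) (C : Matrix m m R) : Matrix (Fin f) (Fin f) (Matrix m m R) :=
  Matrix.of fun i j =>
    if (i : ℕ) = j + 1 then (1 : Matrix m m R) else if (j : ℕ) + 1 = f ∧ (i : ℕ) = 0 then C else 0

/-- Unfolding lemma for `cyclicShiftBlocks`. [folklore] -/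
theorem cyclicShiftBlocks_apply (f : ℕ) (C : Matrix m m R) (i j : Fin f) :
    cyclicShiftBlocks f C i j =
      if (i : ℕ) = j + 1 then (1 : Matrix m m R)
      else if (j : ℕ) + 1 = f ∧ (i : ℕ) = 0 then C else 0 :=
  rfl

/-- The blocks of `S(C)` in terms of the cyclic permutation `finRotate`: block `(i, j)` is nonzero
only for `i = finRotate j`, where it is `C` for `j` the last index and `1` otherwise. [folklore] -/
theorem cyclicShiftBlocks_succ_apply (f' : ℕ) (C : Matrix m m R) (i j : Fin (f' + 1)) :
    cyclicShiftBlocks (f' + 1) C i j =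
      if i = finRotate (f' + 1) j then (if j = Fin.last f' then C else 1) else 0 := by
  rw [cyclicShiftBlocks_apply]
  by_cases hj : j = Fin.last f'
  · subst hj
    rw [finRotate_last, if_pos rfl, if_neg (by rw [Fin.val_last]; omega)]
    by_cases hi : i = 0
    · subst hi
      rw [if_pos ⟨by rw [Fin.val_last], rfl⟩, if_pos rfl]
    · rw [if_neg (fun h => hi (Fin.ext (by rw [h.2, Fin.val_zero]))), if_neg hi]
  · have hjv : ((finRotate (f' + 1) j : Fin (f' + 1)) : ℕ) = j + 1 := coe_finRotate_of_ne_last hj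
    have hjlt : (j : ℕ) < f' := Fin.val_lt_last hj
    rw [if_neg hj]
    by_cases hi : i = finRotate (f' + 1) j
    · rw [if_pos hi, if_pos (by rw [hi, hjv])]
    · rw [if_neg hi, if_neg (fun h => hi (Fin.ext (by rw [hjv]; exact h))), if_neg]
      rintro ⟨h, -⟩
      omega

/-- **Characteristic polynomial of the weighted block cyclic shift**:
`det(X - S(C)) = det(X^f - C) = (charpoly C)(X^f)` for `f ≥ 1`.
Proof: with `U` the block upper unitriangular matrix `U_{t,u} = X^{u-t}` (`t ≤ u`), the product
`U · (X - S(C))` has block rows `(0, …, 0, X^f - C)` (row `0`) and `(0, …, -1, …, X^{f-t})` (`-1` in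
column `t - 1`); after rotating the block rows it is block upper triangular with diagonal blocks
`-1, …, -1, X^f - C`.  So `det(X - S(C)) = ± det(X^f - C)`, and both sides are monic.  (For `m` a
point: Laplace expansion, `Ash2003.charpoly_cyclicShift`.) [folklore] -/
theorem charpoly_comp_cyclicShiftBlocks [Fintype m] {f : ℕ} (hf : 0 < f) (C : Matrix m m R) :
    (Matrix.comp (Fin f) (Fin f) m m R (cyclicShiftBlocks f C)).charpoly =
      C.charpoly.comp (X ^ f) := by
  classical
  nontriviality R
  obtain ⟨f', rfl⟩ : ∃ f', f = f' + 1 := ⟨f - 1, by omega⟩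
  -- notation
  set X' : Matrix m m R[X] := Matrix.scalar m (X : R[X]) with hX'
  set C' : Matrix m m R[X] := C.map Polynomial.C with hC'
  set w : Fin (f' + 1) → Matrix m m R[X] := fun j => if j = Fin.last f' then C' else 1 with hw
  -- the block form `Mb` of the characteristic matrix, the row operations `Ub`, `Nb = Ub * Mb`,
  -- and `Pb` = `Nb` with rotated block rows
  set Mb : Matrix (Fin (f' + 1)) (Fin (f' + 1)) (Matrix m m R[X]) :=
    Matrix.scalar (Fin (f' + 1)) X' -
      (cyclicShiftBlocks (f' + 1) C).map (Polynomial.C : R →+* R[X]).mapMatrix with hMb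
  set Ub : Matrix (Fin (f' + 1)) (Fin (f' + 1)) (Matrix m m R[X]) := Matrix.of fun i j =>
      if (i : ℕ) ≤ j then X' ^ ((j : ℕ) - i) else 0 with hUb
  set Nb : Matrix (Fin (f' + 1)) (Fin (f' + 1)) (Matrix m m R[X]) := Matrix.of fun i j =>
      Ub i j * X' - Ub i (finRotate (f' + 1) j) * w j with hNb
  set Pb : Matrix (Fin (f' + 1)) (Fin (f' + 1)) (Matrix m m R[X]) := Matrix.of fun i j =>
      Nb (finRotate (f' + 1) i) j with hPb
  have hUb_apply : ∀ i j : Fin (f' + 1), Ub i j = if (i : ℕ) ≤ j then X' ^ ((j : ℕ) - i) else 0 :=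
    fun _ _ => rfl
  have hNb_apply : ∀ i j : Fin (f' + 1),
      Nb i j = Ub i j * X' - Ub i (finRotate (f' + 1) j) * w j := fun _ _ => rfl
  have hPb_apply : ∀ i j : Fin (f' + 1), Pb i j = Nb (finRotate (f' + 1) i) j := fun _ _ => rfl
  have hw_last : w (Fin.last f') = C' := if_pos rfl
  have hw_ne : ∀ {j}, j ≠ Fin.last f' → w j = 1 := fun hj => if_neg hj
  -- entries of `Mb`
  have hMb_apply : ∀ l j : Fin (f' + 1), Mb l j =
      (if l = j then X' else 0) - (if l = finRotate (f' + 1) j then w j else 0) := by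
    intro l j
    rw [hMb, Matrix.sub_apply, Matrix.scalar_apply, Matrix.diagonal_apply, Matrix.map_apply,
      cyclicShiftBlocks_succ_apply, RingHom.mapMatrix_apply]
    congr 1
    by_cases h : l = finRotate (f' + 1) j
    · rw [if_pos h, if_pos h]
      by_cases hj : j = Fin.last f'
      · rw [if_pos hj, hj, hw_last]
      · rw [if_neg hj, hw_ne hj, Matrix.map_one _ (map_zero _) (map_one _)]
    · rw [if_neg h, if_neg h, Matrix.map_zero _ (map_zero _)]
  -- (1) the characteristic matrix of `S(C)` is the flattening of `Mb`
  have h1 : (Matrix.comp _ _ m m R (cyclicShiftBlocks (f' + 1) C)).charmatrix =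
      Matrix.comp _ _ m m R[X] Mb := charmatrix_comp _
  -- (2) `Ub * Mb = Nb`
  have h2 : Ub * Mb = Nb := by
    refine Matrix.ext fun i j => ?_
    rw [Matrix.mul_apply, hNb_apply]
    simp only [hMb_apply, mul_sub, Finset.sum_sub_distrib, mul_ite, mul_zero, Finset.sum_ite_eq',
      Finset.mem_univ, if_true]
  -- (3) `det Ub = 1`: block upper triangular with identity diagonal blocks
  have h3 : (Matrix.comp _ _ m m R[X] Ub).det = 1 := by
    have hT : (Matrix.comp _ _ m m R[X] Ub).BlockTriangular Prod.fst := by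
      rintro ⟨i, a⟩ ⟨j, b⟩ hij
      have hij' : (j : ℕ) < i := hij
      rw [Matrix.comp_apply]
      dsimp only
      rw [hUb_apply, if_neg (by omega), Matrix.zero_apply]
    rw [hT.det_fintype]
    refine Finset.prod_eq_one fun k _ => ?_
    rw [det_toSquareBlock_comp, hUb_apply, if_pos le_rfl, Nat.sub_self, pow_zero, Matrix.det_one]
  -- (4) the entries of `Pb`: block upper triangular, diagonal blocks `-1, …, -1, X^f - C'`
  have hP_lower : ∀ i j : Fin (f' + 1), j < i → Pb i j = 0 := by
    intro i j hij
    have hij' : (j : ℕ) < i := hij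
    have hjne : j ≠ Fin.last f' := fun h => by
      rw [h, Fin.val_last] at hij'; have := i.2; omega
    have hjv : ((finRotate (f' + 1) j : Fin (f' + 1)) : ℕ) = j + 1 := coe_finRotate_of_ne_last hjne
    rw [hPb_apply, hNb_apply, hUb_apply, hUb_apply, hjv, hw_ne hjne, mul_one]
    by_cases hi : i = Fin.last f'
    · subst hi
      rw [finRotate_last, Fin.val_zero, if_pos (Nat.zero_le _), if_pos (Nat.zero_le _),
        Nat.sub_zero, Nat.sub_zero, ← pow_succ, sub_self]
    · have hiv : ((finRotate (f' + 1) i : Fin (f' + 1)) : ℕ) = i + 1 := coe_finRotate_of_ne_last hi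
      rw [hiv, if_neg (by omega), if_neg (by omega), zero_mul, sub_zero]
  have hP_diag : ∀ i : Fin (f' + 1), i ≠ Fin.last f' → Pb i i = -1 := by
    intro i hi
    have hiv : ((finRotate (f' + 1) i : Fin (f' + 1)) : ℕ) = i + 1 := coe_finRotate_of_ne_last hi
    rw [hPb_apply, hNb_apply, hUb_apply, hUb_apply, hiv, hw_ne hi, mul_one, if_neg (by omega),
      zero_mul, zero_sub, if_pos le_rfl, Nat.sub_self, pow_zero]
  have hP_last : Pb (Fin.last f') (Fin.last f') = X' ^ (f' + 1) - C' := by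
    rw [hPb_apply, hNb_apply, hUb_apply, hUb_apply, finRotate_last, Fin.val_zero, Fin.val_last,
      hw_last, if_pos (Nat.zero_le _), if_pos le_rfl, Nat.sub_zero, ← pow_succ, pow_zero, one_mul]
  -- (5) `det Pb = ((-1)^m)^f' · det (X^f - C')`
  have h5 : (Matrix.comp _ _ m m R[X] Pb).det =
      ((-1 : R[X]) ^ Fintype.card m) ^ f' * (X' ^ (f' + 1) - C').det := by
    have hT : (Matrix.comp _ _ m m R[X] Pb).BlockTriangular Prod.fst := by
      rintro ⟨i, a⟩ ⟨j, b⟩ hij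
      rw [Matrix.comp_apply]
      dsimp only
      rw [hP_lower i j hij, Matrix.zero_apply]
    rw [hT.det_fintype, Fin.prod_univ_castSucc]
    congr 1
    · rw [Finset.prod_congr rfl fun (k : Fin f') _ => show ((Matrix.comp _ _ m m R[X] Pb).toSquareBlock
          Prod.fst k.castSucc).det = (-1 : R[X]) ^ Fintype.card m by
        rw [det_toSquareBlock_comp, hP_diag _ (Fin.castSucc_lt_last k).ne, Matrix.det_neg,
          Matrix.det_one, mul_one]]
      rw [Finset.prod_const, Finset.card_univ, Fintype.card_fin]
    · rw [det_toSquareBlock_comp, hP_last]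
  -- (6) assemble: `charpoly = det Nb = sign · det Pb`, and kill the sign by monicity
  set σ : Equiv.Perm (Fin (f' + 1) × m) := Equiv.prodCongr (finRotate (f' + 1)) (Equiv.refl m)
    with hσ
  have hPN : (Matrix.comp _ _ m m R[X] Nb).submatrix σ id = Matrix.comp _ _ m m R[X] Pb := by
    ext ⟨i, a⟩ ⟨j, b⟩
    rfl
  have hdet : (Matrix.comp (Fin (f' + 1)) (Fin (f' + 1)) m m R (cyclicShiftBlocks (f' + 1) C)).charpoly =
      (Matrix.comp _ _ m m R[X] Nb).det := by
    rw [Matrix.charpoly, h1, ← h2, comp_mul, Matrix.det_mul, h3, one_mul]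
  have hsign : (Matrix.comp _ _ m m R[X] Nb).det =
      ((Equiv.Perm.sign σ : ℤ) : R[X]) * ((Matrix.comp _ _ m m R[X] Nb).submatrix σ id).det := by
    rw [Matrix.det_permute, ← mul_assoc, ← Int.cast_mul, ← Units.val_mul, Int.units_mul_self,
      Units.val_one, Int.cast_one, one_mul]
  refine eq_of_monic_of_eq_sign_mul (Matrix.charpoly_monic _)
    ((Matrix.charpoly_monic C).comp (monic_X_pow _) (by rw [natDegree_X_pow]; omega))
    (u := ((Equiv.Perm.sign σ : ℤ) : R[X]) * ((-1 : R[X]) ^ Fintype.card m) ^ f') ?_ ?_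
  · rcases Int.units_eq_one_or (Equiv.Perm.sign σ) with h | h <;>
      rcases neg_one_pow_eq_or R[X] (Fintype.card m * f') with h' | h' <;>
      · rw [h, ← pow_mul, h']; simp
  · rw [hdet, hsign, hPN, h5, ← mul_assoc, ← det_scalar_X_pow_sub_map, map_pow]

end CyclicShift

/-! ### Characteristic polynomials of `Ind(π)(g)` for a matrix-valued `π` -/

section Transversal

variable {H G R : Type*} [Group H] [Group G]

/-- For a transversal `r` of `G / φ(H)`, the extension by zero `π̇` of a homomorphism `π` satisfies
`π̇(r_a⁻¹ r_b) = δ_{ab}` (distinct representatives lie in distinct cosets).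
Ref: Serre, *Linear representations of finite groups*, §3.3, proof of Thm. 12. [folklore] -/
theorem dotExtend_inv_mul_of_transversal [MulZeroOneClass R] {ι : Type*} [DecidableEq ι]
    {φ : H →* G} (hφ : Function.Injective φ) (π : H →* R) {r : ι → G}
    (hr : Function.Injective fun i => (r i : G ⧸ φ.range)) (a b : ι) :
    dotExtend φ π ((r a)⁻¹ * r b) = if a = b then 1 else 0 := by
  split_ifs with hab
  · subst hab
    rw [inv_mul_cancel, dotExtend_one hφ]
  · refine dotExtend_of_not_mem φ π fun hmem => hab (hr ?_)
    change (r a : G ⧸ φ.range) = (r b : G ⧸ φ.range)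
    rwa [QuotientGroup.eq]

end Transversal

section Induced

variable {H G : Type*} [Group H] [Group G] {A : Type*} [CommRing A] {m : Type*} [Fintype m]
  [DecidableEq m]

/-- **The characteristic polynomial of `Ind(π)(g)` does not depend on the transversal.**  Two
transversals `r : ι → G`, `r' : ι' → G` of `G / φ(H)` differ by a relabelling `s : ι' ≃ ι` of the
cosets and by moving the representatives inside their cosets, `r'_k = r_{s k} φ(h_k)`, so
`Ind'(π)(g) = D⁻¹ · Ind(π)(g)^s · D` with the block diagonal `D = diag(π(h_k))`
(`indMatrix_mul_map_apply`, `indMatrix_comp_submatrix`); flattening is multiplicative and the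
characteristic polynomial is invariant under conjugation and relabelling (Mathlib
`Matrix.charpoly_mul_comm`, `Matrix.charpoly_reindex`).
Ref: Serre, *Linear representations of finite groups*, §3.3 Thm. 11 (uniqueness of `Ind`). [folklore] -/
theorem charpoly_comp_indMatrix_eq_of_transversal {φ : H →* G} (hφ : Function.Injective φ)
    (π : H →* Matrix m m A) {ι ι' : Type*} [Fintype ι] [DecidableEq ι] [Fintype ι'] [DecidableEq ι']
    {r : ι → G} {r' : ι' → G} (hr : Function.Bijective fun i => (r i : G ⧸ φ.range))
    (hr' : Function.Bijective fun i => (r' i : G ⧸ φ.range)) (g : G) :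
    (Matrix.comp ι' ι' m m A (indMatrix φ π r' g)).charpoly =
      (Matrix.comp ι ι m m A (indMatrix φ π r g)).charpoly := by
  classical
  set er := Equiv.ofBijective _ hr with her
  set er' := Equiv.ofBijective _ hr' with her'
  set s : ι' ≃ ι := er'.trans er.symm with hsdef
  have hsk : ∀ k, (r (s k) : G ⧸ φ.range) = (r' k : G ⧸ φ.range) := fun k =>
    er.apply_symm_apply (er' k)
  have hmem : ∀ k, ∃ a, φ a = (r (s k))⁻¹ * r' k := fun k => QuotientGroup.eq.mp (hsk k)
  choose h hh using hmem
  have hr'eq : r' = fun k => r (s k) * φ (h k) := funext fun k => by rw [hh, mul_inv_cancel_left]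
  have hN' : indMatrix φ π r' g =
      Matrix.diagonal (fun k => π (h k)⁻¹) * (indMatrix φ π r g).submatrix s s *
        Matrix.diagonal (fun k => π (h k)) := by
    refine Matrix.ext fun k k' => ?_
    rw [Matrix.mul_diagonal, Matrix.diagonal_mul, Matrix.submatrix_apply, hr'eq,
      indMatrix_mul_map_apply hφ π (fun k => r (s k)) h g k k']
    rfl
  have h1 : (Matrix.diagonal fun k => π (h k) * π (h k)⁻¹) = (1 : Matrix ι' ι' (Matrix m m A)) := by
    rw [← Matrix.diagonal_one]
    congr 1
    funext k
    rw [← map_mul, mul_inv_cancel, map_one]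
  have h2 : Matrix.comp ι' ι' m m A ((indMatrix φ π r g).submatrix s s) =
      Matrix.reindex (s.prodCongr (Equiv.refl m)).symm (s.prodCongr (Equiv.refl m)).symm
        (Matrix.comp ι ι m m A (indMatrix φ π r g)) := rfl
  rw [hN', comp_mul, comp_mul, Matrix.charpoly_mul_comm, ← Matrix.mul_assoc, ← comp_mul,
    Matrix.diagonal_mul_diagonal, h1, Matrix.comp_one, Matrix.one_mul, h2, Matrix.charpoly_reindex]

/-- **The characteristic polynomial of `Ind(π)(g)` for a matrix-valued `π`** (general, non-normal
`φ(H)`).  Let `φ : H →* G` be injective, `π : H →* M_m(A)`, `r : ι → G` a finite transversal of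
`G / φ(H)` and `g ∈ G`.  Let `τ : κ → G` represent the double cosets `⟨g⟩ \ G / φ(H)`: every `x ∈ G`
is `g^t τ_k φ(a)` (`hcov`) and `τ_{k'} ∈ g^t τ_k φ(H)` forces `k = k'` (`hdisj`); let `f_k ≥ 1` be
the length of the `⟨g⟩`-orbit of the coset `τ_k φ(H)`, i.e. `τ_k⁻¹ g^t τ_k ∈ φ(H) ↔ f_k ∣ t`
(`hs`, `hmin`), and `s_k ∈ H` with `φ(s_k) = τ_k⁻¹ g^{f_k} τ_k`.  Then
`det(X - Ind(π)(g)) = ∏_k det(X^{f_k} - π(s_k)) = ∏_k (charpoly π(s_k))(X^{f_k})`.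
Proof: pass to the transversal `g^t τ_k`, `0 ≤ t < f_k` (`charpoly_comp_indMatrix_eq_of_transversal`),
for which `Ind(π)(g)` is block diagonal with blocks the weighted block cyclic shifts `S(π(s_k))`
(`charpoly_comp_blockDiagonal'`, `charpoly_comp_cyclicShiftBlocks`).  With `G = Γ_K`, `H = Γ_F`,
`g = Frob_𝔓` this is `det(X - Ind(ρ)(Frob_v)) = ∏_{w ∣ v} det(X^{f(w|v)} - ρ(Frob_w))`.  For `m`
a point and `φ(H)` normal: `Literature.NumberTheory.Automorphic.Ash2003.charpoly_indMatrix_eq_prod`.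
Ref: Serre, *Linear representations of finite groups*, §3.3 and §7.3 Prop. 22; Neukirch,
*Algebraic Number Theory*, VII §10, proof of (10.4) (iv). [folklore] -/
theorem charpoly_comp_indMatrix_eq_prod {φ : H →* G} (hφ : Function.Injective φ)
    (π : H →* Matrix m m A) {ι : Type*} [Fintype ι] [DecidableEq ι] {r : ι → G}
    (hr : Function.Bijective fun i => (r i : G ⧸ φ.range)) (g : G)
    {κ : Type*} [Fintype κ] [DecidableEq κ] (τ : κ → G) (f : κ → ℕ) (s : κ → H)
    (hcov : ∀ x : G, ∃ k, ∃ t : ℕ, ∃ a : H, x = g ^ t * τ k * φ a)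
    (hdisj : ∀ (k k' : κ) (t : ℕ) (a : H), τ k' = g ^ t * τ k * φ a → k = k')
    (hf : ∀ k, 0 < f k) (hs : ∀ k, φ (s k) = (τ k)⁻¹ * g ^ f k * τ k)
    (hmin : ∀ (k : κ) (t : ℕ), (τ k)⁻¹ * g ^ t * τ k ∈ φ.range → f k ∣ t) :
    (Matrix.comp ι ι m m A (indMatrix φ π r g)).charpoly =
      ∏ k, (π (s k)).charpoly.comp (X ^ f k) := by
  classical
  -- `τ_k⁻¹ g^t τ_k ∈ φ(H)` iff `f_k ∣ t`
  have hconjpow : ∀ (k : κ) (x : G) (c : ℕ), (τ k)⁻¹ * x ^ c * τ k = ((τ k)⁻¹ * x * τ k) ^ c := by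
    intro k x c
    induction c with
    | zero => simp
    | succ c ih => rw [pow_succ, pow_succ, ← ih]; group
  have hpow : ∀ (k : κ) (t : ℕ), (τ k)⁻¹ * g ^ t * τ k ∈ φ.range ↔ f k ∣ t := by
    intro k t
    refine ⟨hmin k t, fun ⟨c, hc⟩ => ?_⟩
    rw [hc, pow_mul, hconjpow, ← hs k, ← map_pow]
    exact ⟨_, rfl⟩
  -- the transversal adapted to `g`, indexed by `Σ k, Fin (f k)`
  set r' : (Σ k, Fin (f k)) → G := fun tk => g ^ (tk.2 : ℕ) * τ tk.1 with hr'def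
  have hr'a : ∀ (k : κ) (t : Fin (f k)), r' ⟨k, t⟩ = g ^ (t : ℕ) * τ k := fun _ _ => rfl
  have key : ∀ (k k' : κ) (t : Fin (f k)) (t' : Fin (f k')), (t : ℕ) ≤ t' →
      ((r' ⟨k, t⟩ : G ⧸ φ.range) = r' ⟨k', t'⟩) → (⟨k, t⟩ : Σ k, Fin (f k)) = ⟨k', t'⟩ := by
    intro k k' t t' htt' heq
    rw [QuotientGroup.eq, hr'a, hr'a] at heq
    obtain ⟨d, hd⟩ := Nat.exists_eq_add_of_le htt'
    have h1 : (g ^ (t : ℕ) * τ k)⁻¹ * (g ^ (t' : ℕ) * τ k') = (τ k)⁻¹ * g ^ d * τ k' := by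
      rw [hd, pow_add]; group
    rw [h1] at heq
    obtain ⟨a, ha⟩ := heq
    have hkk : k' = k := by
      refine hdisj k' k d a⁻¹ ?_
      rw [map_inv, ha]; group
    subst hkk
    have hmem : (τ k')⁻¹ * g ^ d * τ k' ∈ φ.range := ⟨a, ha⟩
    have h0 : d = 0 := Nat.eq_zero_of_dvd_of_lt ((hpow k' _).mp hmem) (by have := t'.2; omega)
    have : t = t' := Fin.ext (by omega)
    rw [this]
  have hr'inj : Function.Injective fun tk : (Σ k, Fin (f k)) => (r' tk : G ⧸ φ.range) := by
    rintro ⟨k, t⟩ ⟨k', t'⟩ heq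
    rcases le_total (t : ℕ) t' with h | h
    · exact key _ _ _ _ h heq
    · exact (key _ _ _ _ h heq.symm).symm
  have hr'surj : Function.Surjective fun tk : (Σ k, Fin (f k)) => (r' tk : G ⧸ φ.range) := by
    intro q
    induction q using QuotientGroup.induction_on with
    | H x =>
      obtain ⟨k, t, a, rfl⟩ := hcov x
      refine ⟨⟨k, ⟨t % f k, Nat.mod_lt _ (hf k)⟩⟩, ?_⟩
      change (r' _ : G ⧸ φ.range) = _
      rw [QuotientGroup.eq, hr'a]
      have hgt : g ^ t = g ^ (t % f k) * g ^ (f k * (t / f k)) := by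
        rw [← pow_add, Nat.mod_add_div]
      have hx : (g ^ (t % f k) * τ k)⁻¹ * (g ^ t * τ k * φ a) =
          ((τ k)⁻¹ * g ^ (f k * (t / f k)) * τ k) * φ a := by
        rw [hgt]
        group
      rw [hx]
      exact φ.range.mul_mem ((hpow k _).mpr (dvd_mul_right _ _)) ⟨a, rfl⟩
  have hr' : Function.Bijective fun tk : (Σ k, Fin (f k)) => (r' tk : G ⧸ φ.range) :=
    ⟨hr'inj, hr'surj⟩
  rw [← charpoly_comp_indMatrix_eq_of_transversal hφ π hr hr' g]
  -- block form of `Ind(π)(g)` in the adapted transversal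
  have hblock : indMatrix φ π r' g =
      Matrix.blockDiagonal' fun k => cyclicShiftBlocks (f k) (π (s k)) := by
    refine Matrix.ext fun tk tk' => ?_
    rcases tk with ⟨k, t⟩
    rcases tk' with ⟨k', t'⟩
    by_cases hk : k = k'
    · subst hk
      rw [Matrix.blockDiagonal'_apply_eq, cyclicShiftBlocks_apply, indMatrix_apply]
      by_cases hlt : (t' : ℕ) + 1 < f k
      · -- `g · r'(k, t') = r'(k, t' + 1)`
        have h1 : (r' ⟨k, t⟩)⁻¹ * g * r' ⟨k, t'⟩ = (r' ⟨k, t⟩)⁻¹ * r' ⟨k, ⟨(t' : ℕ) + 1, hlt⟩⟩ := by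
          simp only [hr'a, pow_succ]
          group
        rw [h1, dotExtend_inv_mul_of_transversal hφ π hr'.1]
        have hne : ¬ ((t' : ℕ) + 1 = f k ∧ (t : ℕ) = 0) := fun h => absurd h.1 hlt.ne
        rw [if_neg hne]
        by_cases ht : (t : ℕ) = t' + 1
        · rw [if_pos ht, if_pos (show (⟨k, t⟩ : Σ k, Fin (f k)) = ⟨k, ⟨(t' : ℕ) + 1, hlt⟩⟩ from
            congrArg (Sigma.mk k) (Fin.ext ht))]
        · rw [if_neg ht, if_neg]
          intro h
          exact ht (congrArg Fin.val (eq_of_heq (Sigma.mk.inj h).2))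
      · have heq : (t' : ℕ) + 1 = f k := le_antisymm t'.2 (not_lt.mp hlt)
        -- `g · r'(k, t') = r'(k, 0) · φ(s k)`
        have h1 : (r' ⟨k, t⟩)⁻¹ * g * r' ⟨k, t'⟩ =
            (r' ⟨k, t⟩)⁻¹ * r' ⟨k, ⟨0, hf k⟩⟩ * φ (s k) := by
          have hgf : g ^ f k = g ^ (t' : ℕ) * g := by rw [← pow_succ, heq]
          rw [hs k, hgf]
          simp only [hr'a, pow_zero, one_mul]
          group
        rw [h1, dotExtend_mul_map hφ, dotExtend_inv_mul_of_transversal hφ π hr'.1]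
        have ht : ¬ ((t : ℕ) = t' + 1) := by have := t.2; omega
        rw [if_neg ht]
        by_cases ht0 : (t : ℕ) = 0
        · rw [if_pos (show (⟨k, t⟩ : Σ k, Fin (f k)) = ⟨k, ⟨0, hf k⟩⟩ from
            congrArg (Sigma.mk k) (Fin.ext ht0)), one_mul, if_pos ⟨heq, ht0⟩]
        · rw [if_neg, zero_mul, if_neg (fun h => ht0 h.2)]
          intro h
          exact ht0 (congrArg Fin.val (eq_of_heq (Sigma.mk.inj h).2))
    · -- off-orbit blocks vanish
      rw [Matrix.blockDiagonal'_apply_ne _ _ _ hk, indMatrix_apply]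
      refine dotExtend_of_not_mem φ π fun hmem => hk ?_
      obtain ⟨a, ha⟩ := hmem
      rcases Nat.lt_or_ge (t : ℕ) ((t' : ℕ) + 1) with hlt | hge
      · obtain ⟨d, hd⟩ := Nat.exists_eq_add_of_le (Nat.lt_succ_iff.mp hlt)
        refine (hdisj k' k (d + 1) a⁻¹ ?_).symm
        rw [map_inv, ha, hr'a, hr'a, hd, pow_add, pow_succ]
        group
      · obtain ⟨d, hd⟩ := Nat.exists_eq_add_of_le hge
        refine hdisj k k' d a ?_
        rw [ha, hr'a, hr'a, hd, pow_add, pow_succ]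
        group
  rw [hblock, charpoly_comp_blockDiagonal']
  exact Finset.prod_congr rfl fun k _ => charpoly_comp_cyclicShiftBlocks (hf k) _

end Induced

/-! ### Arithmetic: double cosets `⟨Frob_𝔓⟩ \ Γ_K / Γ_F` and the places `w ∣ v`, unramified case -/

section Arithmetic

variable (K : Type u) (F : Type v) [Field K] [NumberField K] [Field F] [NumberField F] [Algebra K F]

-- One long proof with many local definitions (`set`/`choose`); as in
-- `ArtinFormalismInductionProofs`, the default limits are slightly too small for the elaboration of
-- the double-coset bookkeeping (pointwise `Γ_K`-action on ideals of `\bar ℤ_K`).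
set_option maxHeartbeats 400000 in
set_option synthInstance.maxHeartbeats 80000 in
/-- **Double cosets `⟨σ⟩ \ Γ_K / Γ_F` and the places of `F` above `v`, unramified case** (no
normality assumption on `F/K`).  Let `v` be a finite place of the number field `K` such that every
inertia group `I_𝔓' ≤ Γ_K`, `𝔓' ∣ v`, lies in `res(Γ_F)` (i.e. `v` is unramified in the Galois closure
of `F`), `𝔓 ∣ v` a prime of `\bar ℤ_K` and `σ ∈ Γ_K` an arithmetic Frobenius at `𝔓`.  Then there are,
for each place `w ∣ v` of `F`, a prime `𝔔_w ∣ w` of `\bar ℤ_F`, an element `τ_w ∈ Γ_K` and an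
arithmetic Frobenius `s_w ∈ Γ_F` at `𝔔_w` such that:
`res(s_w) = τ_w⁻¹ σ^{f(w|v)} τ_w`; the `τ_w` represent the double cosets `⟨σ⟩ \ Γ_K / res(Γ_F)`
(every `x ∈ Γ_K` is `σ^t τ_w res(a)`, and distinct `w` give distinct double cosets); and `f(w|v)` is
the length of the `⟨σ⟩`-orbit of the coset `τ_w res(Γ_F)`: `τ_w⁻¹ σ^t τ_w ∈ res(Γ_F) ⟹ f(w|v) ∣ t`.
Proof (Neukirch VII §10, proof of (10.4) (iv), with `G_𝔓 = ⟨σ⟩ I_𝔓` modulo the open subgroup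
`τ_w res(Γ_F) τ_w⁻¹ ⊇ I_𝔓`, `exists_eq_frobenius_pow_mul_of_mem_decompositionSubgroup`): the map
`x ↦ ι(x⁻¹ 𝔓) ∩ 𝓞 F` induces the bijection (transitivity of `Γ_K`, `Γ_F` on the primes above a place,
`\bar ℤ_K ≅ \bar ℤ_F`); a Frobenius of `F` at `𝔔_w` restricts to `σ^{f(w|v)}` modulo
`I_𝔓 ≤ τ_w res(Γ_F) τ_w⁻¹`, and conversely `τ_w⁻¹ σ^t τ_w = res(g)` makes `g` act on `𝓞 F / w` as
`x ↦ x^{q^t}` and trivially, so `f(w|v) ∣ t` (`inertiaDeg_dvd_of_forall_pow_residueCard_pow_eq`).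
Ref: Neukirch, *Algebraic Number Theory*, I §9 (9.4)–(9.6); VII §10, proof of (10.4) (iv),
pp. 523–524. [folklore] -/
theorem exists_frobenius_doubleCoset_data {v : HeightOneSpectrum (𝓞 K)}
    {𝔓 : Ideal (absIntegers (𝓞 K) K)} (h𝔓 : 𝔓 ∈ v.primesAbove)
    (hI : ∀ 𝔓' ∈ v.primesAbove,
      𝔓'.inertia (absoluteGaloisGroup K) ≤ (absGaloisRestrict K F).range)
    {σ : absoluteGaloisGroup K} (hσ : IsArithFrobAt (𝓞 K) σ 𝔓) :
    ∃ (𝔔 : {w : HeightOneSpectrum (𝓞 F) // w.under (𝓞 K) = v} → Ideal (absIntegers (𝓞 F) F))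
      (τ : {w : HeightOneSpectrum (𝓞 F) // w.under (𝓞 K) = v} → absoluteGaloisGroup K)
      (s : {w : HeightOneSpectrum (𝓞 F) // w.under (𝓞 K) = v} → absoluteGaloisGroup F),
      (∀ w, 𝔔 w ∈ w.1.primesAbove ∧ IsArithFrobAt (𝓞 F) (s w) (𝔔 w)) ∧
      (∀ w, absGaloisRestrict K F (s w) =
        (τ w)⁻¹ * σ ^ w.1.asIdeal.inertiaDeg (𝓞 K) * τ w) ∧
      (∀ x : absoluteGaloisGroup K, ∃ w, ∃ t : ℕ, ∃ a : absoluteGaloisGroup F,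
        x = σ ^ t * τ w * absGaloisRestrict K F a) ∧
      (∀ (w w' : {w : HeightOneSpectrum (𝓞 F) // w.under (𝓞 K) = v}) (t : ℕ)
        (a : absoluteGaloisGroup F), τ w' = σ ^ t * τ w * absGaloisRestrict K F a → w = w') ∧
      (∀ (w : {w : HeightOneSpectrum (𝓞 F) // w.under (𝓞 K) = v}) (t : ℕ),
        (τ w)⁻¹ * σ ^ t * τ w ∈ (absGaloisRestrict K F).range →
          w.1.asIdeal.inertiaDeg (𝓞 K) ∣ t) := by
  classical
  set res := absGaloisRestrict K F with hres
  set φ : absoluteGaloisGroup F →* absoluteGaloisGroup K := res.toMonoidHom with hφdef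
  have hφa : ∀ γ, φ γ = res γ := fun _ => rfl
  have hrange : res.range = φ.range := rfl
  haveI : FiniteDimensional K F := Module.Finite.right ℚ K F
  set ι := absIntegersMap K F with hι
  haveI h𝔓p : 𝔓.IsPrime := h𝔓.1
  have hwv : ∀ w : {w : HeightOneSpectrum (𝓞 F) // w.under (𝓞 K) = v},
      w.1.asIdeal.under (𝓞 K) = v.asIdeal := fun w => congrArg HeightOneSpectrum.asIdeal w.2
  -- per place `w ∣ v`: a prime `𝔔_w ∣ w` of `\bar ℤ_F` and `τ_w ∈ Γ_K` with `ι⁻¹ 𝔔_w = τ_w⁻¹ 𝔓`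
  have hdata : ∀ w : {w : HeightOneSpectrum (𝓞 F) // w.under (𝓞 K) = v},
      ∃ 𝔔 : Ideal (absIntegers (𝓞 F) F), ∃ τ : absoluteGaloisGroup K,
        𝔔 ∈ w.1.primesAbove ∧ τ • 𝔔.comap ι = 𝔓 := by
    intro w
    obtain ⟨𝔔, h𝔔⟩ := w.1.primesAbove_nonempty
    obtain ⟨τ, hτ⟩ := HeightOneSpectrum.exists_smul_eq_of_mem_primesAbove_holds
      (comap_absIntegersMap_mem_primesAbove (hwv w) h𝔔) h𝔓
    exact ⟨𝔔, τ, h𝔔, hτ⟩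
  choose 𝔔 τ h𝔔 hτ using hdata
  have h𝔔p : ∀ w, (𝔔 w).IsPrime := fun w => (h𝔔 w).1
  have hcomap : ∀ w, (𝔔 w).comap ι = (τ w)⁻¹ • 𝔓 := fun w => by
    rw [← hτ w, inv_smul_smul]
  have hunder : ∀ w, (𝔔 w).under (𝓞 F) = w.1.asIdeal := fun w => (h𝔔 w).2.over.symm
  -- the inertia hypothesis at the conjugate primes: `I_𝔓 ≤ τ_w res(Γ_F) τ_w⁻¹`
  have hIτ : ∀ w, ∀ i ∈ 𝔓.inertia (absoluteGaloisGroup K), (τ w)⁻¹ * i * τ w ∈ φ.range := by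
    intro w i hi
    refine hI _ (smul_mem_primesAbove h𝔓 (τ w)⁻¹) ?_
    have := (Ideal.conj_mem_inertia_smul_iff 𝔓 (τ w)⁻¹ i).mpr hi
    rwa [inv_inv] at this
  -- residue degrees and the Frobenius property
  set f : {w : HeightOneSpectrum (𝓞 F) // w.under (𝓞 K) = v} → ℕ :=
    fun w => w.1.asIdeal.inertiaDeg (𝓞 K) with hf
  have hqw : ∀ w, w.1.residueCard = v.residueCard ^ f w := fun w =>
    residueCard_eq_pow_inertiaDeg_of_under_eq (hwv w)
  -- `τ_w⁻¹ σ^{f_w} τ_w ∈ res(Γ_F)`: a Frobenius of `F` at `𝔔_w` restricts to `σ^{f_w}` modulo `I_𝔓`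
  have hsex : ∀ w : {w : HeightOneSpectrum (𝓞 F) // w.under (𝓞 K) = v},
      ∃ s : absoluteGaloisGroup F, φ s = (τ w)⁻¹ * σ ^ f w * τ w := by
    intro w
    obtain ⟨φw, hφw⟩ := HeightOneSpectrum.exists_isArithFrobAt_of_mem_primesAbove_holds (h𝔔 w)
    have h1 : ∀ x : absIntegers (𝓞 K) K, res φw • x - x ^ v.residueCard ^ f w ∈ (τ w)⁻¹ • 𝔓 := by
      rw [← hcomap w, ← hqw w]
      exact (forall_smul_sub_pow_mem_comap_iff K F (𝔔 w) φw _).mpr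
        ((HeightOneSpectrum.isArithFrobAt_iff_of_mem_primesAbove (h𝔔 w) φw).mp hφw)
    have h2 : ∀ x : absIntegers (𝓞 K) K,
        (τ w * res φw * (τ w)⁻¹) • x - x ^ v.residueCard ^ f w ∈ 𝔓 := fun x => by
      have := forall_conj_smul_sub_pow_mem_smul h1 (τ w) x
      rwa [smul_inv_smul] at this
    have h3 : τ w * res φw * (τ w)⁻¹ * (σ ^ f w)⁻¹ ∈ 𝔓.inertia (absoluteGaloisGroup K) :=
      mul_inv_mem_inertia_of_forall_smul_sub_pow_mem h2 (pow_smul_sub_pow_mem_of_isArithFrobAt h𝔓 hσ _)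
    have h4 := hIτ w _ h3
    have h5 := φ.range.mul_mem (φ.range.inv_mem h4) ⟨φw, rfl⟩
    rw [hφa] at h5
    have : ((τ w)⁻¹ * (τ w * res φw * (τ w)⁻¹ * (σ ^ f w)⁻¹) * τ w)⁻¹ * res φw =
        (τ w)⁻¹ * σ ^ f w * τ w := by group
    rw [this] at h5
    exact h5
  choose s hs using hsex
  -- `s_w` is an arithmetic Frobenius at `𝔔_w`
  have hsFrob : ∀ w, IsArithFrobAt (𝓞 F) (s w) (𝔔 w) := by
    intro w
    haveI := h𝔔p w
    have hsL : ∀ z : absIntegers (𝓞 F) F, s w • z - z ^ v.residueCard ^ f w ∈ 𝔔 w := by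
      rw [← forall_smul_sub_pow_mem_comap_iff K F (𝔔 w) (s w), hcomap w]
      intro x
      have h1 := forall_conj_smul_sub_pow_mem_smul (pow_smul_sub_pow_mem_of_isArithFrobAt h𝔓 hσ (f w))
        (τ w)⁻¹ x
      rw [inv_inv] at h1
      change φ (s w) • x - _ ∈ _
      rw [hs w]
      exact h1
    rw [HeightOneSpectrum.isArithFrobAt_iff_of_mem_primesAbove (h𝔔 w), hqw w]
    exact hsL
  -- minimality of `f_w`
  have hmin : ∀ (w : {w : HeightOneSpectrum (𝓞 F) // w.under (𝓞 K) = v}) (t : ℕ),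
      (τ w)⁻¹ * σ ^ t * τ w ∈ φ.range → f w ∣ t := by
    rintro w t ⟨g, hg⟩
    have hgK : ∀ x : absIntegers (𝓞 K) K, res g • x - x ^ v.residueCard ^ t ∈ (τ w)⁻¹ • 𝔓 := by
      intro x
      have := forall_conj_smul_sub_pow_mem_smul (pow_smul_sub_pow_mem_of_isArithFrobAt h𝔓 hσ t)
        (τ w)⁻¹ x
      rw [inv_inv] at this
      rw [← hφa, hg]
      exact this
    have hgM : ∀ z : absIntegers (𝓞 F) F, g • z - z ^ v.residueCard ^ t ∈ 𝔔 w := by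
      rw [← forall_smul_sub_pow_mem_comap_iff K F (𝔔 w) g, hcomap w]
      exact hgK
    refine inertiaDeg_dvd_of_forall_pow_residueCard_pow_eq (hwv w) fun x => ?_
    obtain ⟨r, rfl⟩ := Ideal.Quotient.mk_surjective x
    rw [← map_pow, Ideal.Quotient.eq, ← hunder w, Ideal.under, Ideal.mem_comap, map_sub, map_pow]
    have := hgM (algebraMap (𝓞 F) (absIntegers (𝓞 F) F) r)
    rw [smul_algebraMap] at this
    rw [← neg_mem_iff, neg_sub]
    exact this
  -- `σ ∈ D_𝔓`; the open subgroups `τ_w res(Γ_F) τ_w⁻¹`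
  set D := 𝔓.decompositionSubgroup (absoluteGaloisGroup K) with hD
  have hσD : σ ∈ D := hσ.mem_stabilizer
  have hopen : IsOpen (φ.range : Set (absoluteGaloisGroup K)) := by
    rw [MonoidHom.coe_range]
    exact isOpen_range_absGaloisRestrict K F
  set U : {w : HeightOneSpectrum (𝓞 F) // w.under (𝓞 K) = v} → Subgroup (absoluteGaloisGroup K) :=
    fun w => φ.range.comap (MulAut.conj (τ w)⁻¹).toMonoidHom with hU
  have hUmem : ∀ w x, x ∈ U w ↔ (τ w)⁻¹ * x * τ w ∈ φ.range := fun w x => by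
    rw [hU, Subgroup.mem_comap, MulEquiv.coe_toMonoidHom, MulAut.conj_apply, inv_inv]
  have hUopen : ∀ w, IsOpen (U w : Set (absoluteGaloisGroup K)) := fun w => by
    have hc : Continuous fun x : absoluteGaloisGroup K => (τ w)⁻¹ * x * (τ w)⁻¹⁻¹ :=
      (continuous_const.mul continuous_id).mul continuous_const
    exact hopen.preimage hc
  -- covering: every `x ∈ Γ_K` lies in some `σ^t τ_w res(Γ_F)`
  have hcov : ∀ x : absoluteGaloisGroup K, ∃ w, ∃ t : ℕ, ∃ a : absoluteGaloisGroup F,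
      x = σ ^ t * τ w * φ a := by
    intro x
    have h𝔓x : x⁻¹ • 𝔓 ∈ v.primesAbove := smul_mem_primesAbove h𝔓 x⁻¹
    set 𝔔x : Ideal (absIntegers (𝓞 F) F) :=
      (x⁻¹ • 𝔓).comap ((absIntegersEquiv K F).symm : absIntegers (𝓞 F) F →+* absIntegers (𝓞 K) K)
      with h𝔔x
    have h𝔔xc : 𝔔x.comap ι = x⁻¹ • 𝔓 := by
      rw [h𝔔x, hι, ← coe_absIntegersEquiv]
      exact Ideal.comap_of_equiv _
    haveI : 𝔔x.IsPrime := by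
      haveI := h𝔓x.1
      exact Ideal.comap_isPrime _ _
    have h𝔔xv : 𝔔x.comap (absIntegersMap K F) ∈ v.primesAbove := by
      rw [← hι, h𝔔xc]
      exact h𝔓x
    obtain ⟨w₀, hw₀, h𝔔xw, -⟩ :=
      exists_heightOneSpectrum_of_comap_absIntegersMap_mem_primesAbove h𝔔xv
    let w : {w : HeightOneSpectrum (𝓞 F) // w.under (𝓞 K) = v} := ⟨w₀, HeightOneSpectrum.ext hw₀⟩
    obtain ⟨γ, hγ⟩ := HeightOneSpectrum.exists_smul_eq_of_mem_primesAbove_holds h𝔔xw (h𝔔 w)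
    have key : (φ γ * x⁻¹) • 𝔓 = (τ w)⁻¹ • 𝔓 := by
      rw [mul_smul, ← h𝔔xc, hφa, ← comap_absIntegersMap_smul, hγ, ← hι, hcomap w]
    have hd' : τ w * φ γ * x⁻¹ ∈ D := by
      rw [hD, Ideal.mem_decompositionSubgroup_iff, mul_assoc, mul_smul, key, smul_inv_smul]
    obtain ⟨n, i, u, hi, hu, heq⟩ :=
      exists_eq_frobenius_pow_mul_of_mem_decompositionSubgroup h𝔓 hσ (hUopen w) (D.inv_mem hd')
    have hiu : (τ w)⁻¹ * (i * u) * τ w ∈ φ.range := by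
      have := φ.range.mul_mem (hIτ w i hi) ((hUmem w u).mp hu)
      convert this using 1
      group
    obtain ⟨b, hb⟩ := φ.range.mul_mem hiu ⟨γ, rfl⟩
    refine ⟨w, n, b, ?_⟩
    rw [hb]
    calc x = (τ w * φ γ * x⁻¹)⁻¹ * τ w * φ γ := by group
      _ = σ ^ n * i * u * τ w * φ γ := by rw [heq]
      _ = σ ^ n * τ w * ((τ w)⁻¹ * (i * u) * τ w * φ γ) := by group
  -- disjointness: distinct places give distinct double cosets
  have hdisj : ∀ (w w' : {w : HeightOneSpectrum (𝓞 F) // w.under (𝓞 K) = v}) (t : ℕ)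
      (a : absoluteGaloisGroup F), τ w' = σ ^ t * τ w * φ a → w = w' := by
    intro w w' t a hEq
    have hd' : (σ ^ t)⁻¹ • 𝔓 = 𝔓 := by
      rw [inv_smul_eq_iff]
      exact (Ideal.mem_decompositionSubgroup_iff.mp (D.pow_mem hσD t)).symm
    have hij : (𝔔 w').comap ι = (a⁻¹ • 𝔔 w).comap ι := by
      rw [hι, comap_absIntegersMap_smul, ← hι, hcomap w, hcomap w', hEq, _root_.mul_inv_rev,
        _root_.mul_inv_rev, mul_smul, mul_smul, hd', map_inv, hφa]
    have hQ : 𝔔 w' = a⁻¹ • 𝔔 w :=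
      Ideal.comap_injective_of_surjective _ (absIntegersMap_surjective K F) hij
    apply Subtype.ext
    apply HeightOneSpectrum.ext
    rw [← hunder w, ← hunder w', hQ, under_smul_absIntegers]
  exact ⟨𝔔, τ, s, fun w => ⟨h𝔔 w, hsFrob w⟩, hs, hcov, hdisj, hmin⟩

end Arithmetic

/-! ### The Frobenius characteristic polynomial of `Ind_{Γ_F}^{Γ_K} ρ` -/

section Induce

variable (K : Type u) {F : Type v} [Field K] [NumberField K] [Field F] [NumberField F] [Algebra K F]
  [FiniteDimensional K F] {A : Type*} [CommRing A] [TopologicalSpace A] {n d : ℕ}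

omit [NumberField F] in
/-- `det(X - Ind(ρ)(g))` is the characteristic polynomial of the flattened block matrix
`(ρ̇(rᵢ⁻¹ g rⱼ))ᵢⱼ` (`indMatrix`, `Matrix.comp`; the relabelling `finProdFinEquiv` does not change
it, Mathlib `Matrix.charpoly_reindex`). [folklore] -/
theorem FramedGaloisRep.charpoly_induce_eq_charpoly_comp_indMatrix (hd : Module.finrank K F = d)
    (ρ : FramedGaloisRep F A n) (g : absoluteGaloisGroup K) :
    FramedRep.charpoly (ρ.induce K hd) g =
      (Matrix.comp (Fin d) (Fin d) (Fin n) (Fin n) A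
        (indMatrix (absGaloisRestrict K F).toMonoidHom (FramedRep.toMatrixHom ρ)
          (absGaloisCosetRep K F hd) g)).charpoly := by
  change ((ρ.induce K hd g : GL (Fin (d * n)) A) : Matrix (Fin (d * n)) (Fin (d * n)) A).charpoly = _
  rw [FramedGaloisRep.induce_def, FramedRep.induce_apply_coe, FramedRep.indFlatHom_apply_eq_reindex,
    Matrix.charpoly_reindex]

-- As above: the default limits are slightly too small for the double-coset bookkeeping.
set_option maxHeartbeats 400000 in
/-- **Frobenius characteristic polynomial of `Ind_{Γ_F}^{Γ_K} ρ`, unramified case** (any rank, any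
finite extension `F/K` of number fields, coefficients in any commutative topological ring).  Let
`[F : K] = d`, `ρ : Γ_F → GL_n(A)` a framed Galois representation, `v` a finite place of `K` such that
every inertia group `I_𝔓' ≤ Γ_K`, `𝔓' ∣ v`, lies in `res(Γ_F)` (`v` unramified in the Galois closure
of `F`; automatic for all but finitely many `v`, `eventually_forall_inertia_le_range_absGaloisRestrict`),
`𝔓 ∣ v` and `σ ∈ Γ_K` an arithmetic Frobenius at `𝔓`.  Then there are primes `𝔔_w ∣ w` of `\bar ℤ_F`
and arithmetic Frobenii `s_w ∈ Γ_F` at `𝔔_w`, one for each place `w ∣ v` of `F`, with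
`det(X - Ind(ρ)(σ)) = ∏_{w ∣ v} det(X^{f(w|v)} - ρ(s_w)) = ∏_{w ∣ v} (charpoly ρ(s_w))(X^{f(w|v)})`.
Proof: `charpoly_comp_indMatrix_eq_prod` (block cyclic shifts in a transversal adapted to `σ`) with
the arithmetic identifications of `exists_frobenius_doubleCoset_data`.  For `n = 1` and `F/K`
Galois this is `FramedGaloisRep.exists_charpoly_induce_eq_prod`
(`Automorphic/AshSmithTheoryHeckeFrobeniusProofs`).
Ref: Neukirch, *Algebraic Number Theory*, VII §10, proof of (10.4) (iv), p. 524; Serre, *Linear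
representations of finite groups*, §3.3, §7.3; Artin, Hamburg Abh. 8 (1931), §2. [folklore] -/
theorem FramedGaloisRep.exists_charpoly_induce_eq_prod_comp (hd : Module.finrank K F = d)
    (ρ : FramedGaloisRep F A n) {v : HeightOneSpectrum (𝓞 K)} {𝔓 : Ideal (absIntegers (𝓞 K) K)}
    (h𝔓 : 𝔓 ∈ v.primesAbove)
    (hI : ∀ 𝔓' ∈ v.primesAbove,
      𝔓'.inertia (absoluteGaloisGroup K) ≤ (absGaloisRestrict K F).range)
    {σ : absoluteGaloisGroup K} (hσ : IsArithFrobAt (𝓞 K) σ 𝔓)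
    [Fintype {w : HeightOneSpectrum (𝓞 F) // w.under (𝓞 K) = v}] :
    ∃ (𝔔 : {w : HeightOneSpectrum (𝓞 F) // w.under (𝓞 K) = v} → Ideal (absIntegers (𝓞 F) F))
      (s : {w : HeightOneSpectrum (𝓞 F) // w.under (𝓞 K) = v} → absoluteGaloisGroup F),
      (∀ w, 𝔔 w ∈ w.1.primesAbove ∧ IsArithFrobAt (𝓞 F) (s w) (𝔔 w)) ∧
        FramedRep.charpoly (ρ.induce K hd) σ =
          ∏ w, (FramedRep.charpoly ρ (s w)).comp (X ^ w.1.asIdeal.inertiaDeg (𝓞 K)) := by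
  classical
  obtain ⟨𝔔, τ, s, h𝔔s, hs, hcov, hdisj, hmin⟩ :=
    exists_frobenius_doubleCoset_data K F h𝔓 hI hσ
  refine ⟨𝔔, s, h𝔔s, ?_⟩
  have hf : ∀ w : {w : HeightOneSpectrum (𝓞 F) // w.under (𝓞 K) = v},
      0 < w.1.asIdeal.inertiaDeg (𝓞 K) := fun w => by
    haveI := w.1.isPrime
    exact Ideal.inertiaDeg_pos w.1.asIdeal (𝓞 K)
  rw [FramedGaloisRep.charpoly_induce_eq_charpoly_comp_indMatrix,
    charpoly_comp_indMatrix_eq_prod (absGaloisRestrict_injective K F) (FramedRep.toMatrixHom ρ)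
      (absGaloisCosetRep_bijective K F hd) σ τ (fun w => w.1.asIdeal.inertiaDeg (𝓞 K)) s hcov hdisj
      hf hs hmin]
  rfl

/-- **The Frobenius characteristic polynomial of an induced representation is the induced Frobenius
polynomial.**  If every arithmetic Frobenius of `F` at every place `w ∣ v` has characteristic
polynomial `P_w` on `ρ` (`ρ.HasFrobCharpolyAt w (P w)`), and every inertia group above `v` lies in
`res(Γ_F)` (true for all but finitely many `v`, `eventually_forall_inertia_le_range_absGaloisRestrict`),
then every arithmetic Frobenius at `v` has characteristic polynomial
`∏_{w ∣ v} P_w(X^{f(w|v)})` (`inducedFrobPolynomial v P`) on `Ind_{Γ_F}^{Γ_K} ρ`.  This is the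
Galois side of `L(s, Ind ρ) = L(s, ρ)` (Artin), place by place, in the `inducedSatakePolynomial`
shape of automorphic induction (Arthur–Clozel, Ch. 3 §6).
Ref: Neukirch, *Algebraic Number Theory*, VII §10 (10.4) (iv); Serre, *Abelian ℓ-adic
representations* (1968), Ch. I §2.3. [folklore] -/
theorem FramedGaloisRep.hasFrobCharpolyAt_induce (hd : Module.finrank K F = d)
    (ρ : FramedGaloisRep F A n) {v : HeightOneSpectrum (𝓞 K)}
    (hI : ∀ 𝔓 ∈ v.primesAbove,
      𝔓.inertia (absoluteGaloisGroup K) ≤ (absGaloisRestrict K F).range)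
    {P : HeightOneSpectrum (𝓞 F) → A[X]}
    (hP : ∀ w : HeightOneSpectrum (𝓞 F), w.asIdeal.under (𝓞 K) = v.asIdeal →
      ρ.HasFrobCharpolyAt w (P w)) :
    (ρ.induce K hd).HasFrobCharpolyAt v (inducedFrobPolynomial v P) := by
  classical
  haveI : Fintype {w : HeightOneSpectrum (𝓞 F) // w.under (𝓞 K) = v} :=
    @Fintype.ofFinite _ (finite_heightOneSpectrum_under_eq v)
  intro 𝔓 h𝔓 σ hσ
  obtain ⟨𝔔, s, h𝔔s, heq⟩ := ρ.exists_charpoly_induce_eq_prod_comp K hd h𝔓 hI hσ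
  rw [heq, inducedFrobPolynomial_eq_prod]
  refine Finset.prod_congr rfl fun w _ => ?_
  rw [hP w.1 (congrArg HeightOneSpectrum.asIdeal w.2) (𝔔 w) (h𝔔s w).1 (s w) (h𝔔s w).2]

/-- **Compatibility of induction with block sums, at the level of Frobenius polynomials**:
under the hypotheses of `hasFrobCharpolyAt_induce` for `ρ₁` (polynomials `P`) and `ρ₂` (`Q`), both
`Ind(ρ₁ ⊞ ρ₂)` and `Ind ρ₁ ⊞ Ind ρ₂` have Frobenius characteristic polynomial
`(∏_{w ∣ v} P_w(X^{f(w|v)})) · (∏_{w ∣ v} Q_w(X^{f(w|v)}))` at `v` (`Ind(ρ₁ ⊕ ρ₂) ≅ Ind ρ₁ ⊕ Ind ρ₂`;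
`inducedFrobPolynomial_mul`, `HasFrobCharpolyAt.blockSum`).
Ref: Serre, *Linear representations of finite groups*, §7.2 (`Ind` is additive). [folklore] -/
theorem FramedGaloisRep.hasFrobCharpolyAt_induce_blockSum {n₁ n₂ : ℕ} (hd : Module.finrank K F = d)
    (ρ₁ : FramedGaloisRep F A n₁) (ρ₂ : FramedGaloisRep F A n₂) {v : HeightOneSpectrum (𝓞 K)}
    (hI : ∀ 𝔓 ∈ v.primesAbove,
      𝔓.inertia (absoluteGaloisGroup K) ≤ (absGaloisRestrict K F).range)
    {P Q : HeightOneSpectrum (𝓞 F) → A[X]}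
    (hP : ∀ w : HeightOneSpectrum (𝓞 F), w.asIdeal.under (𝓞 K) = v.asIdeal →
      ρ₁.HasFrobCharpolyAt w (P w))
    (hQ : ∀ w : HeightOneSpectrum (𝓞 F), w.asIdeal.under (𝓞 K) = v.asIdeal →
      ρ₂.HasFrobCharpolyAt w (Q w)) :
    ((ρ₁.blockSum ρ₂).induce K hd).HasFrobCharpolyAt v
        (inducedFrobPolynomial v P * inducedFrobPolynomial v Q) ∧
      ((ρ₁.induce K hd).blockSum (ρ₂.induce K hd)).HasFrobCharpolyAt v
        (inducedFrobPolynomial v P * inducedFrobPolynomial v Q) := by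
  refine ⟨?_, (ρ₁.hasFrobCharpolyAt_induce K hd hI hP).blockSum (ρ₂.hasFrobCharpolyAt_induce K hd hI hQ)⟩
  rw [← inducedFrobPolynomial_mul]
  exact (ρ₁.blockSum ρ₂).hasFrobCharpolyAt_induce K hd hI fun w hw => (hP w hw).blockSum (hQ w hw)

end Induce

/-! ### Unramifiedness: all but finitely many places qualify -/

section Unramified

variable (K : Type u) (F : Type v) [Field K] [NumberField K] [Field F] [Algebra K F]
  [FiniteDimensional K F]

/-- If `Ind(1)(g) = 1` for the permutation representation `Ind_{Γ_F}^{Γ_K} 1` (coefficients in a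
nontrivial ring), then `g ∈ res(Γ_F)`: the diagonal block of `Ind(1)(g)` at the identity coset is
`1̇(r⁻¹ g r)`, which vanishes unless `r⁻¹ g r ∈ res(Γ_F)`, `r ∈ res(Γ_F)`. [folklore] -/
theorem mem_range_of_induce_one_apply_eq_one {A : Type*} [CommRing A] [TopologicalSpace A]
    [Nontrivial A] {d : ℕ} (hd : Module.finrank K F = d) {g : absoluteGaloisGroup K}
    (hg : FramedGaloisRep.induce K hd (1 : FramedGaloisRep F A 1) g = 1) :
    g ∈ (absGaloisRestrict K F).range := by
  set r := absGaloisCosetRep K F hd with hr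
  obtain ⟨i₀, hi₀⟩ := (absGaloisCosetRep_bijective K F hd).2
    ((1 : absoluteGaloisGroup K) : absoluteGaloisGroup K ⧸ (absGaloisRestrict K F).range)
  have hri₀ : r i₀ ∈ (absGaloisRestrict K F).toMonoidHom.range := by
    have := QuotientGroup.eq.mp hi₀
    rwa [mul_one, inv_mem_iff] at this
  by_contra hgn
  have hmem : (r i₀)⁻¹ * g * r i₀ ∉ (absGaloisRestrict K F).toMonoidHom.range := fun h => by
    apply hgn
    have := Subgroup.mul_mem _ (Subgroup.mul_mem _ hri₀ h) (Subgroup.inv_mem _ hri₀)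
    rwa [show r i₀ * ((r i₀)⁻¹ * g * r i₀) * (r i₀)⁻¹ = g by group] at this
  have hentry := congrArg (fun u : GL (Fin (d * 1)) A =>
    (u : Matrix (Fin (d * 1)) (Fin (d * 1)) A) (finProdFinEquiv (i₀, 0)) (finProdFinEquiv (i₀, 0))) hg
  simp only [FramedGaloisRep.induce_apply_coe_apply, Equiv.symm_apply_apply, Units.val_one,
    Matrix.one_apply_eq] at hentry
  rw [dotExtend_of_not_mem _ _ hmem, Matrix.zero_apply] at hentry
  exact zero_ne_one hentry

/-- **All but finitely many places are unramified in `F` in the Galois-theoretic sense**: for all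
but finitely many finite places `v` of `K`, every inertia group `I_𝔓 ≤ Γ_K`, `𝔓 ∣ v`, lies in
`res(Γ_F)` (hence, the family of these inertia groups being stable under conjugation, in its normal
core `Gal(K̄/F̃)`, `F̃` the Galois closure: `v` is unramified in `F̃`).  Proof: the permutation
representation `Ind_{Γ_F}^{Γ_K} 1 : Γ_K → GL_d(ℤ)` is continuous into a discrete group, so has open
kernel, hence is unramified at all but finitely many `v`
(`FramedGaloisRep.eventually_isUnramifiedAt_of_isOpen_ker`: the places not dividing the different of
the fixed field of the kernel), and `Ind(1)(g) = 1` forces `g ∈ res(Γ_F)`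
(`mem_range_of_induce_one_apply_eq_one`).
Ref: Neukirch, *Algebraic Number Theory*, Ch. III §2, Thm. (2.6) and Cor. (2.12) (only the primes
dividing the discriminant ramify); Serre, *Abelian ℓ-adic representations* (1968), Ch. I §2.1. [folklore] -/
theorem eventually_forall_inertia_le_range_absGaloisRestrict :
    ∀ᶠ v : HeightOneSpectrum (𝓞 K) in Filter.cofinite, ∀ 𝔓 ∈ v.primesAbove,
      𝔓.inertia (absoluteGaloisGroup K) ≤ (absGaloisRestrict K F).range := by
  set P : FramedGaloisRep K ℤ (Module.finrank K F * 1) :=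
    FramedGaloisRep.induce K rfl (1 : FramedGaloisRep F ℤ 1) with hP
  have hker : IsOpen (P.toMonoidHom.ker : Set (absoluteGaloisGroup K)) := by
    have : (P.toMonoidHom.ker : Set (absoluteGaloisGroup K)) = P ⁻¹' {1} := by
      ext g
      simp [MonoidHom.mem_ker]
    rw [this]
    exact (isOpen_discrete _).preimage P.continuous
  filter_upwards [P.eventually_isUnramifiedAt_of_isOpen_ker hker] with v hv
  intro 𝔓 h𝔓 g hg
  exact mem_range_of_induce_one_apply_eq_one K F rfl (hv 𝔓 h𝔓 g hg)

end Unramified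

section UnramifiedInduce

variable (K : Type u) {F : Type v} [Field K] [NumberField K] [Field F] [NumberField F] [Algebra K F]
  [FiniteDimensional K F] {A : Type*} [CommRing A] [TopologicalSpace A] {n d : ℕ}

/-- **`Ind ρ` has the induced Frobenius polynomials at all but finitely many places**: if `ρ` has
Frobenius characteristic polynomial `P_w` at all but finitely many places `w` of `F`, then
`Ind_{Γ_F}^{Γ_K} ρ` has Frobenius characteristic polynomial `∏_{w ∣ v} P_w(X^{f(w|v)})` at all but
finitely many places `v` of `K` (the exceptions: places below an exceptional `w`, and places ramified
in the Galois closure of `F`). [folklore] -/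
theorem FramedGaloisRep.eventually_hasFrobCharpolyAt_induce (hd : Module.finrank K F = d)
    (ρ : FramedGaloisRep F A n) {P : HeightOneSpectrum (𝓞 F) → A[X]}
    (hP : ∀ᶠ w : HeightOneSpectrum (𝓞 F) in Filter.cofinite, ρ.HasFrobCharpolyAt w (P w)) :
    ∀ᶠ v : HeightOneSpectrum (𝓞 K) in Filter.cofinite,
      (ρ.induce K hd).HasFrobCharpolyAt v (inducedFrobPolynomial v P) := by
  have h2 : ∀ᶠ v : HeightOneSpectrum (𝓞 K) in Filter.cofinite, ∀ w : HeightOneSpectrum (𝓞 F),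
      w.asIdeal.under (𝓞 K) = v.asIdeal → ρ.HasFrobCharpolyAt w (P w) := by
    rw [Filter.eventually_cofinite] at hP ⊢
    refine (hP.image fun w => w.under (𝓞 K)).subset fun v hv => ?_
    simp only [Set.mem_setOf_eq, not_forall] at hv
    obtain ⟨w, hw, hbad⟩ := hv
    exact ⟨w, hbad, HeightOneSpectrum.ext hw⟩
  filter_upwards [eventually_forall_inertia_le_range_absGaloisRestrict K F, h2] with v hv1 hv2
  exact ρ.hasFrobCharpolyAt_induce K hd hv1 hv2

end UnramifiedInduce

end Literature.NumberTheory.GaloisRepresentations
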